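import Summits.QuantumFields.YangMills.Theorems.ConvexGribovBodyNonSimplyConnectedLatticeGapCentreFourierTraceBound
import HarnessLib

/-!
# Centre-Fourier trace blindness in OPERATOR form (numerical-radius hypothesis): the multi-slice ∕ non-Hermitian species case

Helper for crux `IRcof` (stmt-QuantumFields-26930), N_cof side — the sorry-free §5 ENGINE of ideator ym-ir-idea-22's LINE 1
«equipartition-seam» (`Cruxes/IRcof/Lines/equipartition_seam.lean`, crux write f36f27a6d7fe; crit-3 verdict pending at extraction time),
extracted VERBATIM by the custody LEAD ym-ir-line-ab-p1 g7 under the LEAD LANE PROTOCOL (pub/ym-ir/STATUS 16:38:18Z (b)): mathematics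
unchanged, namespace moved to the engine's home `…Theorems.NonSimplyConnectedLatticeGap` (the Lines module keeps its own copy until re-cut).

CONTENT (matrix analysis over `Matrix n n ℂ`; no lattice object, no definition, no named fact):
* `norm_trace_mul_le_of_quadForm` — `B ⪰ 0` and `‖⟨v, K v⟩‖ ≤ a ⟨v, v⟩` for all `v` (numerical radius `≤ a`, NO Hermiticity of `K`) ⇒
  `‖tr (B K)‖ ≤ a · Re tr B` (proof: `tr(BK) = Σ_i ⟨√B e_i, K √B e_i⟩`).
* `quadForm_of_loewner` — the Loewner hypothesis `−a ≤ A ≤ a` of the landed engine implies the quadratic-form hypothesis.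
* `centreFourier_traceBlindness_quadForm` — the landed `centreFourier_traceBlindness` (p164278, route ConvexGribovBody, crux 16405, line
  twist-equipartition-blindness) with the Loewner hypothesis replaced by the quadratic-form bound:
  `‖N(k) Z(0) − N(0) Z(k)‖ ≤ (2|α| + 1) a δ (Re Z(0))²` — slab operators of multi-slice species qualify.

HONEST FRAMING: finite-dimensional operator bookkeeping (width 0); nothing here proves N_cof, PXcof, `IRcof`, `IR`, or the Clay Yang–Mills mass
gap (NOT proved anywhere in this tree; R4 = the conditional finite-𝕋⁴ rung `BalabanLadder.UV` only).  Attribution: ym-ir-idea-22 g2∕g3 (author),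
p164278 (the Loewner-form engine).
-/

set_option autoImplicit false

noncomputable section

namespace Summit.QuantumFields.YangMills.Theorems.NonSimplyConnectedLatticeGap

section OperatorForm

open scoped ComplexOrder MatrixOrder
open Matrix

variable {n : Type*} [Fintype n] [DecidableEq n]

/-- **Positivity gives the observable trace inequality, operator form.**  If `B ⪰ 0` and `K` has numerical radius
`≤ a` (`‖⟨v, K v⟩‖ ≤ a ⟨v, v⟩` for all `v`), then `‖tr (B K)‖ ≤ a · Re tr B`.  No Hermiticity of `K` is assumed. -/
theorem norm_trace_mul_le_of_quadForm {B K : Matrix n n ℂ} {a : ℝ} (hB : B.PosSemidef)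
    (hK : ∀ v : n → ℂ, ‖star v ⬝ᵥ (K *ᵥ v)‖ ≤ a * (star v ⬝ᵥ v).re) :
    ‖(B * K).trace‖ ≤ a * B.trace.re := by
  set S : Matrix n n ℂ := CFC.sqrt B with hSdef
  have hSS : S * S = B := CFC.sqrt_mul_sqrt_self B hB.nonneg
  have hSH : Sᴴ = S := (CFC.sqrt_nonneg B).posSemidef.isHermitian
  have hSij : ∀ i j : n, star (S j i) = S i j := fun i j => by
    rw [← Matrix.conjTranspose_apply, hSH]
  -- the columns of `S = √B`
  set c : n → n → ℂ := fun i k => S k i with hcdef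
  have hdiag : ∀ i, (S * K * S) i i = star (c i) ⬝ᵥ (K *ᵥ c i) := by
    intro i
    have h1 : (S * K * S) i i = ∑ a' : n, ∑ b : n, S i a' * K a' b * S b i := by
      simp only [Matrix.mul_apply, Finset.sum_mul]
      rw [Finset.sum_comm]
    have h2 : star (c i) ⬝ᵥ (K *ᵥ c i) = ∑ a' : n, ∑ b : n, S i a' * K a' b * S b i := by
      simp only [hcdef, dotProduct, mulVec, Pi.star_apply, hSij, Finset.mul_sum]
      exact Finset.sum_congr rfl fun a' _ => Finset.sum_congr rfl fun b _ => by ring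
    rw [h1, h2]
  have hnorm : ∀ i, star (c i) ⬝ᵥ c i = B i i := by
    intro i
    rw [← hSS, Matrix.mul_apply]
    simp only [hcdef, dotProduct, Pi.star_apply, hSij]
  have htr : (B * K).trace = ∑ i, star (c i) ⬝ᵥ (K *ᵥ c i) := by
    rw [← hSS, ← Matrix.trace_mul_cycle S K S]
    simp only [Matrix.trace, Matrix.diag_apply, hdiag]
  have htrB : B.trace.re = ∑ i, (star (c i) ⬝ᵥ c i).re := by
    simp only [Matrix.trace, Matrix.diag_apply, Complex.re_sum, hnorm]
  rw [htr, htrB, Finset.mul_sum]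
  exact (norm_sum_le _ _).trans (Finset.sum_le_sum fun i _ => hK (c i))

/-- The Loewner hypothesis of the landed engine implies the quadratic-form hypothesis (so the operator form below
GENERALISES `centreFourier_traceBlindness`): `−a ≤ A ≤ a` gives `‖⟨v, A v⟩‖ ≤ a ⟨v, v⟩`. -/
theorem quadForm_of_loewner {A : Matrix n n ℂ} {a : ℝ}
    (hA₁ : ((a : ℂ) • (1 : Matrix n n ℂ) - A).PosSemidef) (hA₂ : ((a : ℂ) • (1 : Matrix n n ℂ) + A).PosSemidef)
    (v : n → ℂ) : ‖star v ⬝ᵥ (A *ᵥ v)‖ ≤ a * (star v ⬝ᵥ v).re := by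
  have h1 := hA₁.dotProduct_mulVec_nonneg v
  have h2 := hA₂.dotProduct_mulVec_nonneg v
  rw [Matrix.sub_mulVec, Matrix.smul_mulVec, Matrix.one_mulVec, dotProduct_sub, dotProduct_smul,
    smul_eq_mul] at h1
  rw [Matrix.add_mulVec, Matrix.smul_mulVec, Matrix.one_mulVec, dotProduct_add, dotProduct_smul,
    smul_eq_mul] at h2
  obtain ⟨h1re, h1im⟩ := Complex.nonneg_iff.mp h1
  obtain ⟨h2re, h2im⟩ := Complex.nonneg_iff.mp h2
  have hvv : (star v ⬝ᵥ v).im = 0 :=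
    ((Complex.nonneg_iff.mp (dotProduct_star_self_nonneg v)).2).symm
  simp only [Complex.sub_re, Complex.sub_im, Complex.add_re, Complex.add_im, Complex.mul_re, Complex.mul_im,
    Complex.ofReal_re, Complex.ofReal_im, zero_mul, sub_zero, add_zero, hvv, mul_zero] at h1re h1im h2re h2im
  have him : (star v ⬝ᵥ (A *ᵥ v)).im = 0 := by linarith
  have hz : star v ⬝ᵥ (A *ᵥ v) = (((star v ⬝ᵥ (A *ᵥ v)).re : ℝ) : ℂ) :=
    Complex.ext (by simp) (by simp [him])
  rw [hz, Complex.norm_real, Real.norm_eq_abs]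
  exact abs_le.mpr ⟨by linarith, by linarith⟩

/-- **Abstract electric blindness, operator form** — `centreFourier_traceBlindness` with the Loewner hypothesis on
`A` replaced by the quadratic-form bound `‖⟨v, A v⟩‖ ≤ a ⟨v, v⟩` (no Hermiticity: slab operators of multi-slice
species qualify).  Proof = the landed proof verbatim with `norm_trace_mul_le_of_quadForm` for
`norm_trace_mul_le_of_loewner` (attribution: p164278, route ConvexGribovBody, crux 16405). -/
theorem centreFourier_traceBlindness_quadForm : ∀ (n : Type) [Fintype n] [DecidableEq n] (α : Type)
    [AddCommGroup α] [Fintype α] [DecidableEq α] (U : α → Matrix n n ℂ) (X A : Matrix n n ℂ)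
    (a δ : ℝ), U 0 = 1 → (∀ x y : α, U (x + y) = U x * U y) → (∀ x : α, (U x)ᴴ = U (-x)) →
    X.PosSemidef → (∀ x : α, U x * X = X * U x) → 0 ≤ a →
    (∀ v : n → ℂ, ‖star v ⬝ᵥ (A *ᵥ v)‖ ≤ a * (star v ⬝ᵥ v).re) →
    0 ≤ δ → (∀ x : α, ‖(U x * X).trace - X.trace‖ ≤ δ * X.trace.re) → ∀ x : α,
    ‖(U x * X * A).trace * X.trace - (X * A).trace * (U x * X).trace‖
      ≤ (2 * (Fintype.card α : ℝ) + 1) * a * δ * X.trace.re ^ 2 := by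
  intro n _ _ α _ _ _ U X A a δ hU0 hUadd hUstar hX hUX ha hA hδ hequi x
  -- the character projections and their three properties
  set P : AddChar α ℂ → Matrix n n ℂ :=
    fun ψ => (Fintype.card α : ℂ)⁻¹ • ∑ b : α, ψ (-b) • U b with hPdef
  have hPX : ∀ ψ, (P ψ * X).PosSemidef := fun ψ =>
    posSemidef_proj_mul (charProj_isHermitian U hUstar ψ) (charProj_mul_self U hUadd ψ)
      (charProj_comm U X hUX ψ) hX
  have hAψ : ∀ ψ, ‖(P ψ * X * A).trace‖ ≤ a * (P ψ * X).trace.re := fun ψ =>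
    norm_trace_mul_le_of_quadForm (hPX ψ) hA
  have hZψ : ∀ ψ : AddChar α ℂ, ψ ≠ 0 → ‖(P ψ * X).trace‖ ≤ δ * X.trace.re := fun ψ hψ =>
    charProj_trace_le_of_equipartition U X ψ hψ δ hequi
  -- Fourier expansion of the twisted observable traces
  have hexp : ∀ y : α, (U y * X * A).trace = ∑ ψ : AddChar α ℂ, ψ y * (P ψ * X * A).trace := by
    intro y
    conv_lhs => rw [← sum_char_smul_charProj U y]
    rw [Finset.sum_mul, Finset.sum_mul, Matrix.trace_sum]
    refine Finset.sum_congr rfl fun ψ _ => ?_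
    rw [Matrix.smul_mul, Matrix.smul_mul, Matrix.trace_smul, smul_eq_mul]
  have hZ0re : 0 ≤ X.trace.re := (Complex.nonneg_iff.mp hX.trace_nonneg).1
  have hZ0norm : ‖X.trace‖ = X.trace.re := by
    obtain ⟨hre, him⟩ := Complex.nonneg_iff.mp hX.trace_nonneg
    have hz : X.trace = ((X.trace.re : ℝ) : ℂ) := Complex.ext (by simp) (by simp [← him])
    rw [hz, Complex.norm_real, Real.norm_eq_abs, abs_of_nonneg hre, Complex.ofReal_re]
  -- (1) the difference of observable traces is carried by the non-trivial fluxes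
  have hdiff : ‖(U x * X * A).trace - (X * A).trace‖
      ≤ 2 * Fintype.card α * a * δ * X.trace.re := by
    have h0 : (X * A).trace = ∑ ψ : AddChar α ℂ, (P ψ * X * A).trace := by
      have := hexp 0
      simpa [hU0] using this
    rw [hexp x, h0, ← Finset.sum_sub_distrib]
    calc ‖∑ ψ : AddChar α ℂ, (ψ x * (P ψ * X * A).trace - (P ψ * X * A).trace)‖
        ≤ ∑ ψ : AddChar α ℂ, ‖ψ x * (P ψ * X * A).trace - (P ψ * X * A).trace‖ :=
          norm_sum_le _ _
      _ ≤ ∑ ψ : AddChar α ℂ, 2 * a * δ * X.trace.re := by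
          refine Finset.sum_le_sum fun ψ _ => ?_
          by_cases hψ : ψ = 0
          · subst hψ
            simp only [AddChar.zero_apply, one_mul, sub_self, norm_zero]
            positivity
          · rw [← sub_one_mul, norm_mul]
            have h1 : ‖ψ x - 1‖ ≤ 2 := by
              calc ‖ψ x - 1‖ ≤ ‖ψ x‖ + ‖(1 : ℂ)‖ := norm_sub_le _ _
                _ = 2 := by rw [AddChar.norm_apply, norm_one]; norm_num
            have h2 : ‖(P ψ * X * A).trace‖ ≤ a * (δ * X.trace.re) :=
              (hAψ ψ).trans (mul_le_mul_of_nonneg_left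
                ((Complex.re_le_norm _).trans (hZψ ψ hψ)) ha)
            calc ‖ψ x - 1‖ * ‖(P ψ * X * A).trace‖ ≤ 2 * (a * (δ * X.trace.re)) :=
                  mul_le_mul h1 h2 (norm_nonneg _) (by norm_num)
              _ = 2 * a * δ * X.trace.re := by ring
      _ = 2 * Fintype.card α * a * δ * X.trace.re := by
          rw [Finset.sum_const, Finset.card_univ, AddChar.card_eq, nsmul_eq_mul]
          ring
  -- (2) the untwisted observable trace is bounded by positivity
  have hN0 : ‖(X * A).trace‖ ≤ a * X.trace.re := norm_trace_mul_le_of_quadForm hX hA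
  -- (3) equipartition for the partition functions themselves
  have hZ : ‖X.trace - (U x * X).trace‖ ≤ δ * X.trace.re := by
    rw [norm_sub_rev]; exact hequi x
  -- assemble
  have key : (U x * X * A).trace * X.trace - (X * A).trace * (U x * X).trace
      = ((U x * X * A).trace - (X * A).trace) * X.trace
        + (X * A).trace * (X.trace - (U x * X).trace) := by ring
  rw [key]
  calc ‖((U x * X * A).trace - (X * A).trace) * X.trace
          + (X * A).trace * (X.trace - (U x * X).trace)‖
      ≤ ‖((U x * X * A).trace - (X * A).trace) * X.trace‖
          + ‖(X * A).trace * (X.trace - (U x * X).trace)‖ := norm_add_le _ _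
    _ = ‖(U x * X * A).trace - (X * A).trace‖ * X.trace.re
          + ‖(X * A).trace‖ * ‖X.trace - (U x * X).trace‖ := by
          rw [norm_mul, norm_mul, hZ0norm]
    _ ≤ (2 * Fintype.card α * a * δ * X.trace.re) * X.trace.re
          + (a * X.trace.re) * (δ * X.trace.re) := by
          gcongr
    _ = (2 * Fintype.card α + 1) * a * δ * X.trace.re ^ 2 := by ring

end OperatorForm

end Summit.QuantumFields.YangMills.Theorems.NonSimplyConnectedLatticeGap

end
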